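import Summits.HodgeConjecture.HodgeConjecture.Theorems.LimitExtensionHodgeFourfoldsOfFacts
import Summits.HodgeConjecture.HodgeConjecture.Theorems.LimitExtensionMiddleDivisorSupportSufficesSNCPrinciple
import Summits.HodgeConjecture.HodgeConjecture.Theorems.LimitExtensionSpecialisationOfAlgebraicityOfSpreadFact
import Literature.AlgebraicGeometry.HodgeTheory.GysinKernelSNC
import Literature.AlgebraicGeometry.HodgeTheory.LefschetzOneOneOfKodairaSerre
import Literature.AlgebraicGeometry.HodgeTheory.KodairaSerreSections

/-!
# Route LimitExtension · `HodgeFourfolds` (stmt-HodgeConjecture-10866) — the divisor descent on the snc principle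

Companion of `Theorems/LimitExtensionHodgeFourfoldsOfFacts` (`hodgeFourfolds_of_two_binders`: the
route decl `HodgeFourfolds` from Lefschetz `(1,1)` on fourfolds, the divisor descent of rational
`(2,2)`-classes, and the route's support item `SpecialisationOfAlgebraicity`, stmt-HodgeConjecture-2998)
and of `Theorems/LimitExtensionHodgeFourfoldsOfTwoFacts` (the same on the named facts
`lefschetzOneOne_rational` and Deligne's Hodge III Cor. 8.2.8 for ARBITRARY families,
`Deligne1974_ker_restrictCompl_eq_iSup_range_complexGysin`).

Since `Theorems/LimitExtensionMiddleDivisorSupportSufficesSNCPrinciple` (2026-08-16) the divisor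
descent — route decl `DivisorInduction` (stmt-HodgeConjecture-1082) — follows from ONE Hodge-theoretic
statement strictly weaker than Cor. 8.2.8 / Prop. 8.2.7 for arbitrary families: the snc case of
Prop. 8.2.7 (the "principle of two types" on the members of a simple-normal-crossings boundary,
Deligne–Griffiths–Morgan–Sullivan 1975 §5–§6), now catalogued as the named fact
`Deligne1974_ker_pullback_eq_ker_pullback_snc` (`HodgeTheory/GysinKernelSNC`); log resolution,
Voisin's lift of Hodge classes along Gysin surjections, hard Lefschetz and Hodge models being
theorems of the tree (`divisorInduction_of_snc827`). Feeding it: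

* `hodgeFourfolds_of_snc` — **`HodgeFourfolds` from the snc principle, Lefschetz `(1,1)` and
  stmt-2998**;
* `hodgeFourfolds_of_snc_of_kodairaSerre` — the same with Lefschetz `(1,1)` replaced by its leaf, the
  Kodaira–Serre existence of sections of an algebraic twist
  (`kodairaSerre_exists_globalSection_algebraicTwist`, Serre GAGA n° 16–17;
  `lefschetzOneOne_rational_of_kodairaSerre_fact`).

So the item is closed modulo exactly: the snc principle, the Kodaira–Serre sections, and
stmt-HodgeConjecture-2998 — whose own residual input is the spreading of fibrewise algebraic
supports for a PROPER, not necessarily projective, total space `W` (Hilbert algebraic spaces /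
Chow's lemma; `specialisationOfAlgebraicity_of_localSpread`), because the `∃`-clause of the crux
`LimitExtensionFour` asks of `f : W ⟶ T` only flatness and properness.

The last two theorems record what a TIGHTENED crux would buy. If the witness family of
`LimitExtensionFour` is in addition asked to have `W` quasi-projective over `ℂ`
(`IsQuasiProjectiveOver W` — still implied by the Hodge conjecture: the pencil of hypersurfaces
through a generic projection of `X` over an affine curve is quasi-projective), then the
specialisation step is the tree's `map_comp_fiberι_mem_supportedClasses_one_of_isQuasiProjectiveOver`
on the named fact `spread_supports_over_smoothCurve` (relative Hilbert schemes of a projective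
morphism over a curve, Voisin II §3.3.1), and the Hodge conjecture for ALL smooth projective
fourfolds follows from the two cruxes and THREE NAMED FACTS of the Literature, with no open route
item in between:

* `limitExtension_mem_supportedClasses_four_one_qp` — divisor support of rational `(2,2)`-classes
  from the tightened crux, `HypersurfaceHodgeFour` and the spreading fact;
* `hodgeConjectureFor_four_of_three_facts_qp` — HC for every smooth projective fourfold from Hodge
  models, the tightened crux, `HypersurfaceHodgeFour`, and the three named facts.

The codimension bookkeeping common to all versions is `hodgeConjectureFor_four_of_middle`
(codimension `0`, `4`, `≥ 5` by the tree; `1` by Lefschetz `(1,1)`; `3` by hard Lefschetz,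
`nonempty_hardLefschetzNFold_holds`, Murre 1977 Remark 1; `2` the hypothesis). No definitions, no
named facts.
-/

noncomputable section

-- every declaration of this problem lives in `Summit.HodgeConjecture.HodgeConjecture.…` (summit = sub-problem)
set_option linter.dupNamespace false

open CategoryTheory AlgebraicGeometry
open Literature.AlgebraicGeometry Literature.AlgebraicGeometry.Motives
open Literature.AlgebraicGeometry.HodgeTheory

namespace Summit.HodgeConjecture.HodgeConjecture.Theorems

/-! ### The item on the snc principle -/

/-- **`HodgeFourfolds` (stmt-HodgeConjecture-10866) from the snc principle of two types, Lefschetz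
`(1,1)` and the specialisation lemma.** Granted the snc case of Deligne's Hodge III Prop. 8.2.7
(`hS`, named fact `Deligne1974_ker_pullback_eq_ker_pullback_snc`), Lefschetz `(1,1)` (`hL`, Voisin I
Thm. 11.30) and the route's Hodge-free specialisation lemma (`hSp`, stmt-HodgeConjecture-2998), Hodge
models + `LimitExtensionFour` + `HypersurfaceHodgeFour` give the Hodge conjecture for every smooth
projective complex fourfold: `hodgeFourfolds_of_two_binders` with its Lefschetz binder fed `hL` and
its divisor-descent binder fed the route decl `DivisorInduction` at `(n, p) = (3, 2)`
(`divisorInduction_of_snc827 hS`, whose codimension-one input on the resolved threefold components is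
`hL` again). [cite: DeligneHodgeIII1974, Prop. 8.2.7 and Cor. 8.2.8]
[cite: DeligneGriffithsMorganSullivan1975, §5–§6] [cite: VoisinHodgeI2002, Thm. 11.30]
[cite: Murre1977, Remark 1 (p. 230)] [cite: Thomas2005Nodes, Prop. 2] -/
theorem hodgeFourfolds_of_snc (hS : Deligne1974_ker_pullback_eq_ker_pullback_snc)
    (hL : lefschetzOneOne_rational) (hSp : Theses.LimitExtension.SpecialisationOfAlgebraicity) :
    Theses.LimitExtension.HodgeFourfolds :=
  hodgeFourfolds_of_two_binders (fun _X hX c hc hpp ↦ hL hX c hc hpp)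
    (fun _X hX c hc hpp hN ↦ divisorInduction_of_snc827 hS 3 2 one_le_two
      (fun _Y hY a ha haa ↦ hL hY a ha haa) hX c hc hpp hN) hSp

/-- **`HodgeFourfolds` on the two Literature LEAVES plus stmt-2998**: the snc principle of two types
(`hS`) and the Kodaira–Serre existence of sections of an algebraic twist (`hKS`, named fact
`kodairaSerre_exists_globalSection_algebraicTwist` ⟹ Lefschetz `(1,1)` by the tree's
`lefschetzOneOne_rational_of_kodairaSerre_fact`: meromorphic sections, Čech integrality, Chow's
theorem and the analytic `(1,1)` theorem, all proved), with the route's specialisation lemma `hSp`.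
CLOSING RECIPE for the item: the day both facts are discharged and stmt-2998 is proved,
`hodgeFourfolds_of_snc_of_kodairaSerre ‹snc›_holds ‹kodairaSerre›_holds ‹2998›` is the route decl.
[cite: SerreGAGA1956, n° 16–17] [cite: VoisinHodgeI2002, Cor. 11.34 (proof) and Thm. 11.30]
[cite: DeligneHodgeIII1974, Prop. 8.2.7] [cite: DeligneGriffithsMorganSullivan1975, §5–§6] -/
theorem hodgeFourfolds_of_snc_of_kodairaSerre (hS : Deligne1974_ker_pullback_eq_ker_pullback_snc)
    (hKS : kodairaSerre_exists_globalSection_algebraicTwist)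
    (hSp : Theses.LimitExtension.SpecialisationOfAlgebraicity) :
    Theses.LimitExtension.HodgeFourfolds :=
  hodgeFourfolds_of_snc hS (lefschetzOneOne_rational_of_kodairaSerre_fact hKS) hSp

/-! ### The codimension bookkeeping on one fourfold -/

/-- **The Hodge conjecture for ONE smooth projective fourfold from its codimension-`1` and
codimension-`2` cases.** For `X` smooth projective of dimension `4` with a Hodge model: if rational
`(1,1)`-classes are algebraic on every smooth projective fourfold (`hLef`; used on `X` in codimension
`1` and, through hard Lefschetz — the tree's theorem `nonempty_hardLefschetzNFold_holds` with
`mem_algebraicClasses_of_lt_of_nonempty`, Murre 1977 Remark 1 "the `(3,3)`-conjecture is true for any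
fourfold" — in codimension `3`) and rational `(2,2)`-classes on `X` are algebraic (`hMid`), then
`HodgeConjectureFor 4 X`; codimensions `0`, `4` and `≥ 5` are the tree's
`hodgeConjectureFor_codim_zero`, `mem_algebraicClasses_of_degree_top` and
`IsOfHodgeType.eq_zero_pp_of_lt`. [cite: Murre1977, Remark 1 (p. 230)]
[cite: VoisinHodgeI2002, Thm. 6.25 and §11.3] -/
theorem hodgeConjectureFor_four_of_middle {X : SchemeOver ℂ} (hX : IsSmoothProjective 4 X)
    (hA : Nonempty (HodgeModel 4 X))
    (hLef : ∀ Y : SchemeOver ℂ, IsSmoothProjective 4 Y → ∀ c : complexBetti Y (2 * 1),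
      IsRationalClass c → IsOfHodgeType 4 Y (2 * 1) 1 1 c → c ∈ algebraicClasses Y 1)
    (hMid : ∀ c : complexBetti X (2 * 2), IsRationalClass c → IsOfHodgeType 4 X (2 * 2) 2 2 c →
      c ∈ algebraicClasses X 2) :
    HodgeConjectureFor 4 X := by
  refine ⟨hA, fun p c hc hpp ↦ ?_⟩
  rcases Nat.lt_or_ge 4 p with h4p | hp4
  · -- codimension `p ≥ 5`: no `(p,p)`-classes above the dimension, `c = 0`
    rw [hpp.eq_zero_pp_of_lt h4p]
    exact Submodule.zero_mem _
  interval_cases p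
  · -- codimension `0`: `N⁰ H⁰ = H⁰`
    exact hodgeConjectureFor_codim_zero c
  · -- codimension `1`: Lefschetz `(1,1)`
    exact hLef X hX c hc hpp
  · -- the middle degree `p = 2`
    exact hMid c hc hpp
  · -- codimension `3` (the `(3,3)`-conjecture): hard Lefschetz from codimension `1`
    exact mem_algebraicClasses_of_lt_of_nonempty (p := 3)
      (nonempty_hardLefschetzNFold_holds (n := 4) (X := X)) hX (by norm_num)
      (fun a ha haa ↦ hLef X hX a ha haa) c hc hpp
  · -- codimension `4`: the class of a point
    exact mem_algebraicClasses_of_degree_top hX (by norm_num) c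

/-! ### What a quasi-projective witness family buys: the fourfold conjecture on three named facts -/

/-- **Divisor support of rational `(2,2)`-classes from a QUASI-PROJECTIVE limit extension.** The
hypothesis `hLE` is the crux `LimitExtensionFour` with ONE clause added to its `∃`: the total space
`W` of the witness family is quasi-projective over `ℂ` (`IsQuasiProjectiveOver W`). Then, granted the
spreading of fibrewise algebraic supports over a smooth curve (`hF`, named fact
`spread_supports_over_smoothCurve`: relative Hilbert schemes of the projective morphism
`f|_{T ∖ t₀}`, countability, flat limits — Voisin II §3.3.1 / proof of Thm. 10.19), `HypersurfaceHodgeFour`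
on the smooth hypersurface fibres makes `B|_{W_t}` algebraic (`t ≠ t₀`; rational by
`IsRationalClass.pullback`, of type `(2,2)` by the family), the tree's
`map_comp_fiberι_mem_supportedClasses_one_of_isQuasiProjectiveOver` (the specialisation lemma for
quasi-projective `W`, from `hF`) puts `(g ≫ ι_{t₀})^* B` in `N¹H⁴(X)`, and
`c = (c - (g ≫ ι_{t₀})^* B) + (g ≫ ι_{t₀})^* B ∈ supportedClasses X 4 1`.
[cite: VoisinHodgeII2003, §3.3.1 and Thm. 10.19 (proof)] [cite: Fulton1998, §10.1 and §20.3]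
[cite: Thomas2005Nodes, Prop. 2] -/
theorem limitExtension_mem_supportedClasses_four_one_qp (hF : spread_supports_over_smoothCurve)
    (hLE : ∀ ⦃X : SchemeOver ℂ⦄, IsSmoothProjective 4 X → ∀ α : complexBetti X 4,
      IsRationalClass α → IsOfHodgeType 4 X 4 2 2 α →
      ∃ (T W : SchemeOver ℂ) (f : W ⟶ T) (t₀ : ComplexPoints T) (g : X ⟶ fiberOver f t₀)
        (B : complexBetti W 4),
        SmoothOfRelativeDimension 1 T.hom ∧ IrreducibleSpace T.left ∧ Flat f.left ∧
        IsProper f.left ∧ IsQuasiProjectiveOver W ∧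
        (∃ U : X.left.Opens, (U : Set X.left).Nonempty ∧ IsOpenImmersion (U.ι ≫ g.left)) ∧
        IsRationalClass B ∧
        (∀ t : ComplexPoints T, t ≠ t₀ →
          (∃ d : ℕ, IsSmoothHypersurface 4 d (fiberOver f t)) ∧
          IsOfHodgeType 4 (fiberOver f t) 4 2 2 (complexBetti.map (fiberι f t) 4 B)) ∧
        α - complexBetti.map (g ≫ fiberι f t₀) 4 B ∈ supportedClasses X 4 1)
    (hH : Theses.LimitExtension.HypersurfaceHodgeFour)
    {X : SchemeOver ℂ} (hX : IsSmoothProjective 4 X) (c : complexBetti X 4)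
    (hc : IsRationalClass c) (h22 : IsOfHodgeType 4 X 4 2 2 c) :
    c ∈ supportedClasses X 4 1 := by
  obtain ⟨T, W, f, t₀, g, B, hT, hirr, hflat, hprop, hW, hU, hB, hfib, hdiff⟩ := hLE hX c hc h22
  haveI := hirr
  have hpull : complexBetti.map (g ≫ fiberι f t₀) 4 B ∈ supportedClasses X 4 1 := by
    refine map_comp_fiberι_mem_supportedClasses_one_of_isQuasiProjectiveOver hF (k := 2) f t₀ g B
      two_pos hX hT hW hflat hprop hU fun t ht ↦ ?_
    obtain ⟨⟨d, hd⟩, htype⟩ := hfib t ht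
    exact ⟨hd.1, (hH hd).2 2 _ (hB.pullback _) htype⟩
  have h := Submodule.add_mem _ hdiff hpull
  rwa [sub_add_cancel] at h

/-- **The Hodge conjecture for all smooth projective fourfolds from the two cruxes and THREE NAMED
FACTS, granted a quasi-projective witness family.** Hypotheses: the snc principle of two types
(`hS`, `Deligne1974_ker_pullback_eq_ker_pullback_snc`), the Kodaira–Serre sections (`hKS`,
`kodairaSerre_exists_globalSection_algebraicTwist`), the spreading of supports over a curve (`hF`,
`spread_supports_over_smoothCurve`) — three catalogued Literature facts —, Hodge models (the route's
support item `HodgeModels`, inline), the crux `LimitExtensionFour` with its `∃`-clause tightened by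
`IsQuasiProjectiveOver W` (`hLE`), and the crux `HypersurfaceHodgeFour` (`hH`). Conclusion:
`HodgeConjectureFor 4 X` for every smooth projective fourfold `X`. Proof:
`hodgeConjectureFor_four_of_middle` with Lefschetz `(1,1)` from `hKS`
(`lefschetzOneOne_rational_of_kodairaSerre_fact`) and the middle degree from
`limitExtension_mem_supportedClasses_four_one_qp` followed by the divisor descent
`divisorInduction_of_snc827 hS` at `(3, 2)`. This is the item `HodgeFourfolds` with its first crux so
tightened; for the crux as filed (`W` merely proper over the curve) see `hodgeFourfolds_of_snc_of_kodairaSerre`,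
where the third input is the open support item stmt-HodgeConjecture-2998 instead of `hF`.
[cite: DeligneHodgeIII1974, Prop. 8.2.7] [cite: DeligneGriffithsMorganSullivan1975, §5–§6]
[cite: SerreGAGA1956, n° 16–17] [cite: VoisinHodgeII2003, §3.3.1] [cite: Murre1977, Remark 1 (p. 230)]
[cite: Thomas2005Nodes, Prop. 2] -/
theorem hodgeConjectureFor_four_of_three_facts_qp (hS : Deligne1974_ker_pullback_eq_ker_pullback_snc)
    (hKS : kodairaSerre_exists_globalSection_algebraicTwist) (hF : spread_supports_over_smoothCurve)
    (hModels : ∀ ⦃n : ℕ⦄ ⦃X : SchemeOver ℂ⦄, IsSmoothProjective n X → Nonempty (HodgeModel n X))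
    (hLE : ∀ ⦃X : SchemeOver ℂ⦄, IsSmoothProjective 4 X → ∀ α : complexBetti X 4,
      IsRationalClass α → IsOfHodgeType 4 X 4 2 2 α →
      ∃ (T W : SchemeOver ℂ) (f : W ⟶ T) (t₀ : ComplexPoints T) (g : X ⟶ fiberOver f t₀)
        (B : complexBetti W 4),
        SmoothOfRelativeDimension 1 T.hom ∧ IrreducibleSpace T.left ∧ Flat f.left ∧
        IsProper f.left ∧ IsQuasiProjectiveOver W ∧
        (∃ U : X.left.Opens, (U : Set X.left).Nonempty ∧ IsOpenImmersion (U.ι ≫ g.left)) ∧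
        IsRationalClass B ∧
        (∀ t : ComplexPoints T, t ≠ t₀ →
          (∃ d : ℕ, IsSmoothHypersurface 4 d (fiberOver f t)) ∧
          IsOfHodgeType 4 (fiberOver f t) 4 2 2 (complexBetti.map (fiberι f t) 4 B)) ∧
        α - complexBetti.map (g ≫ fiberι f t₀) 4 B ∈ supportedClasses X 4 1)
    (hH : Theses.LimitExtension.HypersurfaceHodgeFour) :
    ∀ ⦃X : SchemeOver ℂ⦄, IsSmoothProjective 4 X → HodgeConjectureFor 4 X := by
  have hL : lefschetzOneOne_rational := lefschetzOneOne_rational_of_kodairaSerre_fact hKS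
  intro X hX
  refine hodgeConjectureFor_four_of_middle hX (hModels hX) (fun Y hY c hc hpp ↦ hL hY c hc hpp)
    fun c hc hpp ↦ ?_
  exact divisorInduction_of_snc827 hS 3 2 one_le_two (fun _Y hY a ha haa ↦ hL hY a ha haa) hX c hc
    hpp (limitExtension_mem_supportedClasses_four_one_qp hF hLE hH hX c hc hpp)

end Summit.HodgeConjecture.HodgeConjecture.Theorems

end
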